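import Summits.QuantumFields.YangMills.Theorems.ColdStartUniversalityShenZhuZhuGradientFormSU2
import Summits.QuantumFields.YangMills.Theorems.ColdStartUniversalityLatticeLangevinSharpCarreOfLipschitz
import Summits.QuantumFields.YangMills.Theorems.ColdStartUniversalityLatticeLangevinHerbstArgument
import HarnessLib

/-!
# Route `ColdStartUniversality` (fixed-cut-off package): GAUSSIAN CONCENTRATION OF LIPSCHITZ CYLINDER OBSERVABLES under every infinite-volume
# limit point of `SU(2)` lattice Yang–Mills in `d = 3` at `|β| < 1/24` — `μ{F ≥ μF + r} ≤ exp(−K r²/(2 Σ_e L_e²))`, `K = 1 − 24|β|`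

Helper file (seat `ym-line-csu-p1`, g38; `--supports stmt-QuantumFields-24809`).  Herbst's argument (the tree's `measureReal_ge_le_exp_of_entropy_le`,
g26) run on the GRADIENT-form log-Sobolev inequality for infinite-volume limit points (`szzGradientForm_su2_sharp`, g38): for a smooth cylinder
function `F = f((U_e)_(e∈Λ))` that is `L_e`-Lipschitz in the link `e` (Frobenius distance — Shen–Zhu–Zhu's hypothesis class), the link gradients of
`e^(λF/2)` are `(λ/2)e^(λF/2)|∇_e F| ≤ (λ/2)e^(λF/2)L_e`, so `Ent_μ(e^(λF)) ≤ (λ²Σ_e L_e²/(2K)) μ(e^(λF))` and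
* `linkGradSq_exp_mul` — chain rule `|∇_e e^(cF)|² = c² e^(2cF) |∇_e F|²`;
* ★ `linkGradSq_le_sq_of_linkLipschitz` — `|∇_e F|²(U) ≤ L_e²` at every `SU(2)`-valued configuration (the `𝔰𝔲(2)`-restricted frame trick
  `sum_sq_apply_frame_le_of_skew` + the flow `M_e ↦ e^(sY)M_e`, `‖e^(sY) − 1‖_F ≤ s‖Y‖_F`);
* ★★★ `szz_laplace_le_su2_sharp` — `μ(e^(λF)) ≤ exp(λ μ(F) + λ² Σ_e L_e²/(2K))`, `K = 1 − 24|β|`, every `λ ≥ 0`;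
* ★★★ `szz_concentration_su2_sharp` — `μ{U : μ(F) + r ≤ F(U)} ≤ exp(−K r²/(2 Σ_e L_e²))` for every `r ≥ 0` — sub-Gaussian fluctuations of EVERY
  Lipschitz local observable (Wilson loops, plaquette strings, …) under EVERY infinite-volume strong-coupling state of 3D `SU(2)` lattice Yang–Mills,
  with Shen–Zhu–Zhu's curvature constant (cf. their Cor. 1.5, a variance bound); the venture `YMGap` had Chebyshev-type variance bounds only.
THEOREMS ONLY, no definition, no sorry.  HONEST FRAMING: STRONG coupling (`|β| < 1/24` 't Hooft), fixed lattice; nothing at weak coupling / in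
the continuum, nothing `K`-uniform along the route's scaling (`UniformColdStartMixing`, 24809, ASIDE, not restated); no crux, rung or summit
statement is proved; the Yang–Mills mass gap is NOT proved.
-/

set_option autoImplicit false

noncomputable section

namespace Summit.QuantumFields.YangMills.Theorems.ColdStartUniversality

open MeasureTheory ProbabilityTheory Finset Filter Set Metric
open scoped BigOperators NNReal ENNReal Topology Matrix.Norms.Frobenius ContDiff
open Literature.Probability.Process Literature.MathematicalPhysics.QuantumFieldTheory
open Literature.MathematicalPhysics.QuantumLattice (fundamentalRep fundamentalLatticeRep continuous_fundamentalRep fundamentalRep_apply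
  infiniteVolumeLimitPoints IsInfiniteVolumeLimitAlong IsCylinder LGConfig)

/-! ## §1. Link gradients: chain rule for `exp`, and the Lipschitz bound -/

/-- **The link curve is differentiable through `f`**: for differentiable `f`, `t ↦ f(M with M_e ↦ e^(tA)M_e)` has derivative
`Df(M)[single_e(A M_e)]` at `0`. [folklore] -/
theorem hasDerivAt_linkCurve {d N : ℕ} (Λ : Finset (Literature.MathematicalPhysics.QuantumLattice.ZdEdge d))
    {f : (↥Λ → Matrix (Fin N) (Fin N) ℂ) → ℝ} (hf : Differentiable ℝ f) (e : ↥Λ) (M : ↥Λ → Matrix (Fin N) (Fin N) ℂ)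
    (A : Matrix (Fin N) (Fin N) ℂ) :
    HasDerivAt (fun t : ℝ => f (Function.update M e (NormedSpace.exp (t • A) * M e)))
      (fderiv ℝ f M (Pi.single e (A * M e))) 0 := by
  classical
  have hc : HasDerivAt (fun t : ℝ => NormedSpace.exp (t • A) * M e) (A * NormedSpace.exp ((0 : ℝ) • A) * M e) 0 :=
    (hasDerivAt_exp_smul_const' (𝕂 := ℝ) A (0 : ℝ)).mul_const (M e)
  have hc' : HasDerivAt (fun t : ℝ => NormedSpace.exp (t • A) * M e) (A * M e) 0 := by
    have h := hc
    rwa [zero_smul, NormedSpace.exp_zero, mul_one] at h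
  have hc0 : NormedSpace.exp ((0 : ℝ) • A) * M e = M e := by rw [zero_smul, NormedSpace.exp_zero, one_mul]
  have huc : HasDerivAt (fun t : ℝ => Function.update M e (NormedSpace.exp (t • A) * M e))
      (Pi.single e (A * M e) : ↥Λ → Matrix (Fin N) (Fin N) ℂ) 0 := by
    have h := (hasFDerivAt_update M (i := e) (NormedSpace.exp ((0 : ℝ) • A) * M e)).comp_hasDerivAt (0 : ℝ) hc'
    refine h.congr_deriv ?_
    funext i
    rw [ContinuousLinearMap.pi_apply]
    by_cases hi : i = e
    · subst hi; simp
    · simp [hi]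
  have hbase : Function.update M e (NormedSpace.exp ((0 : ℝ) • A) * M e) = M := by
    rw [hc0, Function.update_eq_self]
  have hf' : HasFDerivAt f (fderiv ℝ f M) (Function.update M e (NormedSpace.exp ((0 : ℝ) • A) * M e)) := by
    rw [hbase]; exact (hf M).hasFDerivAt
  exact hf'.comp_hasDerivAt (0 : ℝ) huc

/-- **Chain rule for `exp`**: `|∇_e e^(c·F)|²(M) = (c·e^(c F(M)))² · |∇_e F|²(M)` for differentiable `f`. [folklore] -/
theorem linkGradSq_exp_mul {d N : ℕ} (Λ : Finset (Literature.MathematicalPhysics.QuantumLattice.ZdEdge d))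
    {f : (↥Λ → Matrix (Fin N) (Fin N) ℂ) → ℝ} (hf : Differentiable ℝ f) (c : ℝ) (e : ↥Λ) (M : ↥Λ → Matrix (Fin N) (Fin N) ℂ) :
    linkGradSq Λ (fun m => Real.exp (c * f m)) e M = (c * Real.exp (c * f M)) ^ 2 * linkGradSq Λ f e M := by
  classical
  unfold linkGradSq
  rw [Finset.mul_sum]
  refine Finset.sum_congr rfl fun α _ => ?_
  have h1 := hasDerivAt_linkCurve Λ hf e M (SUNBakryEmery.frame α)
  have hval : f (Function.update M e (NormedSpace.exp ((0 : ℝ) • SUNBakryEmery.frame α) * M e)) = f M := by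
    rw [zero_smul, NormedSpace.exp_zero, one_mul, Function.update_eq_self]
  have h2 : HasDerivAt (fun t : ℝ => Real.exp (c * f (Function.update M e (NormedSpace.exp (t • SUNBakryEmery.frame α) * M e))))
      (Real.exp (c * f M) * (c * fderiv ℝ f M (Pi.single e (SUNBakryEmery.frame α * M e)))) 0 := by
    have h := ((h1.const_mul c).exp)
    rw [hval] at h
    exact h
  rw [h1.deriv, h2.deriv]
  ring

/-- ★ **Link gradients from link-Lipschitz constants** (Shen–Zhu–Zhu's "`|∇_e F| ≤ L_e` since chords are shorter than arcs"): if `f` is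
differentiable and `L`-Lipschitz in the link `e` along `SU(N)^Λ` (Frobenius distance, other links frozen), then at every `SU(N)`-valued
configuration `|∇_e F|²(U) = linkGradSq Λ f e U ≤ L²`. [cite: ShenZhuZhu2022, §2 (2.3)–(2.4) and Corollary 4.5] -/
theorem linkGradSq_le_sq_of_linkLipschitz {d N : ℕ} (hN : N ≠ 0) (Λ : Finset (Literature.MathematicalPhysics.QuantumLattice.ZdEdge d))
    {f : (↥Λ → Matrix (Fin N) (Fin N) ℂ) → ℝ} (hf : Differentiable ℝ f) (e : ↥Λ) {L : ℝ} (hL : 0 ≤ L)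
    (hLip : ∀ (M M' : ↥Λ → Matrix.specialUnitaryGroup (Fin N) ℂ), (∀ e', e' ≠ e → M e' = M' e') →
      |f (fun e' => (M e' : Matrix (Fin N) (Fin N) ℂ)) - f (fun e' => (M' e' : Matrix (Fin N) (Fin N) ℂ))| ≤ L * suFrobDist (M e) (M' e))
    (U : ↥Λ → Matrix.specialUnitaryGroup (Fin N) ℂ) :
    linkGradSq Λ f e (fun e' => (U e' : Matrix (Fin N) (Fin N) ℂ)) ≤ L ^ 2 := by
  classical
  set M : ↥Λ → Matrix (Fin N) (Fin N) ℂ := fun e' => (U e' : Matrix (Fin N) (Fin N) ℂ) with hM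
  -- the linear functional `A ↦ Df(M)[single_e(A M_e)]`
  set ι : Matrix (Fin N) (Fin N) ℂ → (↥Λ → Matrix (Fin N) (Fin N) ℂ) := fun A => Pi.single e (A * M e) with hι
  have hιadd : ∀ A B, ι (A + B) = ι A + ι B := by
    intro A B; simp only [hι, Matrix.add_mul, Pi.single_add]
  have hιsmul : ∀ (a : ℝ) A, ι (a • A) = a • ι A := by
    intro a A; simp only [hι, Matrix.smul_mul, Pi.single_smul]
  let ιl : Matrix (Fin N) (Fin N) ℂ →ₗ[ℝ] (↥Λ → Matrix (Fin N) (Fin N) ℂ) := { toFun := ι, map_add' := hιadd, map_smul' := hιsmul }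
  let lam : Matrix (Fin N) (Fin N) ℂ →ₗ[ℝ] ℝ := (fderiv ℝ f M).toLinearMap.comp ιl
  have hlam : ∀ A, lam A = fderiv ℝ f M (Pi.single e (A * M e)) := fun A => rfl
  have hrepr : linkGradSq Λ f e M = ∑ α : SUNBakryEmery.FrameIdx N, lam (SUNBakryEmery.frame α) ^ 2 := by
    rw [linkGradSq_eq_sum_sq_fderiv Λ hf e M]
    simp only [hlam]
  rw [hrepr]
  refine sum_sq_apply_frame_le_of_skew hN lam fun A hA hA0 => ?_
  rw [hlam]
  -- the flow `s ↦ e^(sA) M_e` stays in `SU(N)`; slopes are bounded by `L‖A‖_F`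
  have hUe : (M e) ∈ Matrix.unitaryGroup (Fin N) ℂ := Matrix.specialUnitaryGroup_le_unitaryGroup (U e).2
  set Us : ℝ → (↥Λ → Matrix.specialUnitaryGroup (Fin N) ℂ) := fun s => Function.update U e (SUNBakryEmery.expSU hA hA0 s * U e) with hUs
  have hcoe : ∀ s, (fun e' => ((Us s e' : Matrix.specialUnitaryGroup (Fin N) ℂ) : Matrix (Fin N) (Fin N) ℂ)) =
      Function.update M e (NormedSpace.exp (s • A) * M e) := by
    intro s; funext e'
    by_cases h : e' = e
    · subst h
      rw [Function.update_self]
      show (((Function.update U e' (SUNBakryEmery.expSU hA hA0 s * U e')) e' : Matrix.specialUnitaryGroup (Fin N) ℂ) : Matrix (Fin N) (Fin N) ℂ) = _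
      rw [Function.update_self]
      rfl
    · rw [Function.update_of_ne h]
      show (((Function.update U e (SUNBakryEmery.expSU hA hA0 s * U e)) e' : Matrix.specialUnitaryGroup (Fin N) ℂ) : Matrix (Fin N) (Fin N) ℂ) = _
      rw [Function.update_of_ne h]
  have hder : HasDerivAt (fun s : ℝ => f (Function.update M e (NormedSpace.exp (s • A) * M e)))
      (fderiv ℝ f M (Pi.single e (A * M e))) 0 := hasDerivAt_linkCurve Λ hf e M A
  -- `‖e^(sA) − 1‖_F ≤ s ‖A‖_F`
  have hXu : ∀ r : ℝ, NormedSpace.exp (r • A) ∈ Matrix.unitaryGroup (Fin N) ℂ := fun r =>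
    Matrix.specialUnitaryGroup_le_unitaryGroup (SUNBakryEmery.expSU hA hA0 r).2
  have hEder : ∀ r : ℝ, HasDerivAt (fun r : ℝ => NormedSpace.exp (r • A)) (A * NormedSpace.exp (r • A)) r := fun r =>
    hasDerivAt_exp_smul_const' (𝕂 := ℝ) A r
  have hEbound : ∀ s : ℝ, 0 ≤ s → frobNorm (NormedSpace.exp (s • A) - 1) ≤ s * frobNorm A := by
    intro s hs
    have hMV := norm_image_sub_le_of_norm_deriv_le_segment' (f := fun r : ℝ => NormedSpace.exp (r • A)) (a := (0 : ℝ)) (b := s)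
      (C := frobNorm A) (fun r _ => (hEder r).hasDerivWithinAt)
      (fun r _ => by rw [← frobNorm_eq_norm, frobNorm_mul_unitary _ (hXu r)]) s (Set.right_mem_Icc.2 hs)
    rw [zero_smul, NormedSpace.exp_zero, sub_zero, ← frobNorm_eq_norm] at hMV
    rw [mul_comm]; exact hMV
  set φ : ℝ → ℝ := fun s => f (Function.update M e (NormedSpace.exp (s • A) * M e)) with hφ
  have hφ0 : φ 0 = f M := by
    simp only [hφ, zero_smul, NormedSpace.exp_zero, one_mul, Function.update_eq_self]
  have hslope : ∀ s : ℝ, 0 < s → |slope φ 0 s| ≤ L * frobNorm A := by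
    intro s hs
    have h1 : |φ s - φ 0| ≤ L * frobNorm (NormedSpace.exp (s • A) - 1) := by
      have h := hLip (Us s) U (fun e' hne => by rw [hUs]; exact Function.update_of_ne hne _ _)
      rw [hcoe s] at h
      have hdist : suFrobDist (Us s e) (U e) = frobNorm (NormedSpace.exp (s • A) - 1) := by
        show frobNorm (((Us s e : Matrix.specialUnitaryGroup (Fin N) ℂ) : Matrix (Fin N) (Fin N) ℂ) - M e) = _
        have hc : ((Us s e : Matrix.specialUnitaryGroup (Fin N) ℂ) : Matrix (Fin N) (Fin N) ℂ) = NormedSpace.exp (s • A) * M e := by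
          have := congrFun (hcoe s) e
          rwa [Function.update_self] at this
        rw [hc, show NormedSpace.exp (s • A) * M e - M e = (NormedSpace.exp (s • A) - 1) * M e by rw [Matrix.sub_mul, Matrix.one_mul],
          frobNorm_mul_unitary _ hUe]
      rw [hdist] at h
      rw [hφ0]
      exact h
    rw [slope_def_field, sub_zero, abs_div, abs_of_pos hs, div_le_iff₀ hs]
    calc |φ s - φ 0| ≤ L * frobNorm (NormedSpace.exp (s • A) - 1) := h1
      _ ≤ L * (s * frobNorm A) := mul_le_mul_of_nonneg_left (hEbound s hs.le) hL
      _ = L * frobNorm A * s := by ring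
  have htend : Tendsto (fun s => |slope φ 0 s|) (𝓝[>] (0 : ℝ)) (𝓝 |fderiv ℝ f M (Pi.single e (A * M e))|) :=
    ((hder.tendsto_slope.mono_left (nhdsWithin_mono _ fun s (hs : 0 < s) => ne_of_gt hs))).abs
  exact le_of_tendsto htend (eventually_nhdsWithin_of_forall fun s hs => hslope s hs)

/-! ## §2. Laplace transform bound and Gaussian concentration for every infinite-volume limit point -/

/-- ★★★ **Laplace-transform bound for Lipschitz cylinder observables, every infinite-volume limit point, `|β| < 1/24`.**  For every limit point
`μ` of the torus `SU(2)` Wilson states at tree coupling `2β`, every finite `Λ ⊆ E⁺(ℤ³)`, every smooth `f` of the link matrices over `Λ` that is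
`L_e`-Lipschitz in the link `e` (Frobenius distance), and every `λ ≥ 0`:
`∫ e^(λF) dμ ≤ exp(λ ∫F dμ + λ²·Σ_e L_e²/(2(1 − 24|β|)))`, `F = f((U_e)_(e∈Λ))` (Herbst's argument on the gradient-form log-Sobolev inequality).
[cite: ShenZhuZhu2022, Theorem 1.4 (1.9) and Corollary 1.5] -/
theorem szz_laplace_le_su2_sharp {β : ℝ} (hβ : |β| < 1 / 24)
    {μ : Measure (LGConfig 3 (Matrix.specialUnitaryGroup (Fin 2) ℂ))}
    (hμ : μ ∈ infiniteVolumeLimitPoints (d := 3) (fundamentalRep (Fin 2)) (((2 : ℕ) : ℝ) * β))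
    (Λ : Finset (Literature.MathematicalPhysics.QuantumLattice.ZdEdge 3)) (f : (↥Λ → Matrix (Fin 2) (Fin 2) ℂ) → ℝ) (hf : ContDiff ℝ ∞ f)
    (L : ↥Λ → ℝ) (hL : ∀ e, 0 ≤ L e)
    (hLip : ∀ (e : ↥Λ) (M M' : ↥Λ → Matrix.specialUnitaryGroup (Fin 2) ℂ), (∀ e', e' ≠ e → M e' = M' e') →
      |f (fun e' => (M e' : Matrix (Fin 2) (Fin 2) ℂ)) - f (fun e' => (M' e' : Matrix (Fin 2) (Fin 2) ℂ))| ≤ L e * suFrobDist (M e) (M' e))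
    {l : ℝ} (hl : 0 ≤ l) :
    ∫ U, Real.exp (l * matrixCylinder Λ f U) ∂μ ≤
      Real.exp (l * (∫ U, matrixCylinder Λ f U ∂μ) + (∑ e, L e ^ 2) / (2 * (1 - 24 * |β|)) * l ^ 2) := by
  classical
  obtain ⟨Ls, hLs, hprob, hlim⟩ := hμ
  haveI := hprob
  have hμ' : μ ∈ infiniteVolumeLimitPoints (d := 3) (fundamentalRep (Fin 2)) (((2 : ℕ) : ℝ) * β) := ⟨Ls, hLs, hprob, hlim⟩
  have hK : 0 < 1 - 24 * |β| := by linarith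
  set F : LGConfig 3 (Matrix.specialUnitaryGroup (Fin 2) ℂ) → ℝ := matrixCylinder Λ f with hF
  have hres : Continuous fun U : LGConfig 3 (Matrix.specialUnitaryGroup (Fin 2) ℂ) =>
      (fun e' : ↥Λ => ((U e'.1 : Matrix.specialUnitaryGroup (Fin 2) ℂ) : Matrix (Fin 2) (Fin 2) ℂ)) :=
    continuous_pi fun e => continuous_subtype_val.comp (continuous_apply _)
  have hFc : Continuous F := hf.continuous.comp hres
  have hFm : Measurable F := hFc.measurable
  obtain ⟨C, hC⟩ : ∃ C, ∀ U, |F U| ≤ C := by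
    obtain ⟨C, hC⟩ := (isCompact_univ (X := LGConfig 3 (Matrix.specialUnitaryGroup (Fin 2) ℂ))).exists_bound_of_continuousOn hFc.continuousOn
    exact ⟨C, fun U => by simpa [Real.norm_eq_abs] using hC U (Set.mem_univ _)⟩
  have hfd : Differentiable ℝ f := hf.differentiable (by simp)
  have hN : (2 : ℕ) ≠ 0 := by norm_num
  -- Herbst's entropy hypothesis from the gradient-form log-Sobolev inequality applied to `e^(λF/2)`
  have hEnt : ∀ t : ℝ, 0 < t →
      (∫ U, (t * F U) * Real.exp (t * F U) ∂μ) - (∫ U, Real.exp (t * F U) ∂μ) * Real.log (∫ U, Real.exp (t * F U) ∂μ) ≤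
        (∑ e, L e ^ 2) / (2 * (1 - 24 * |β|)) * t ^ 2 * ∫ U, Real.exp (t * F U) ∂μ := by
    intro t ht
    set g : (↥Λ → Matrix (Fin 2) (Fin 2) ℂ) → ℝ := fun m => Real.exp (t / 2 * f m) with hg
    have hgC : ContDiff ℝ ∞ g := Real.contDiff_exp.comp (contDiff_const.mul hf)
    have hLS := (szzGradientForm_su2_sharp hβ hμ' Λ g hgC).1
    -- `G² = e^(tF)`, `log G² = tF`
    have hG2 : ∀ U, matrixCylinder Λ g U ^ 2 = Real.exp (t * F U) := by
      intro U
      show Real.exp (t / 2 * f _) ^ 2 = Real.exp (t * f _)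
      rw [sq, ← Real.exp_add]; ring_nf
    simp_rw [hG2, Real.log_exp] at hLS
    -- the link gradients of `g`
    have hgrad : ∀ (e : ↥Λ) (U : LGConfig 3 (Matrix.specialUnitaryGroup (Fin 2) ℂ)),
        linkGradSq Λ g e (fun e' : ↥Λ => ((U e'.1 : Matrix.specialUnitaryGroup (Fin 2) ℂ) : Matrix (Fin 2) (Fin 2) ℂ)) ≤
          (t / 2) ^ 2 * Real.exp (t * F U) * L e ^ 2 := by
      intro e U
      have h1 := linkGradSq_exp_mul Λ hfd (t / 2) e (fun e' : ↥Λ => ((U e'.1 : Matrix.specialUnitaryGroup (Fin 2) ℂ) : Matrix (Fin 2) (Fin 2) ℂ))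
      have h2 := linkGradSq_le_sq_of_linkLipschitz hN Λ hfd e (hL e) (hLip e) (fun e' : ↥Λ => U e'.1)
      have hexp : Real.exp (t / 2 * f (fun e' : ↥Λ => ((U e'.1 : Matrix.specialUnitaryGroup (Fin 2) ℂ) : Matrix (Fin 2) (Fin 2) ℂ))) ^ 2 =
          Real.exp (t * F U) := by
        show Real.exp (t / 2 * f _) ^ 2 = Real.exp (t * f _)
        rw [sq, ← Real.exp_add]; ring_nf
      have hge : linkGradSq Λ g e (fun e' : ↥Λ => ((U e'.1 : Matrix.specialUnitaryGroup (Fin 2) ℂ) : Matrix (Fin 2) (Fin 2) ℂ)) =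
          (t / 2) ^ 2 * Real.exp (t * F U) *
            linkGradSq Λ f e (fun e' : ↥Λ => ((U e'.1 : Matrix.specialUnitaryGroup (Fin 2) ℂ) : Matrix (Fin 2) (Fin 2) ℂ)) := by
        show linkGradSq Λ (fun m => Real.exp (t / 2 * f m)) e _ = _
        rw [h1, mul_pow, hexp]
      rw [hge]
      exact mul_le_mul_of_nonneg_left h2 (by positivity)
    -- integrate
    have hexpc : Continuous fun U => Real.exp (t * F U) := Real.continuous_exp.comp (continuous_const.mul hFc)
    have hexpi : Integrable (fun U => Real.exp (t * F U)) μ := integrable_of_continuous_of_compactSpace hexpc _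
    have hsum_le : ∑ e : ↥Λ, ∫ U, linkGradSq Λ g e (fun e' : ↥Λ => ((U e'.1 : Matrix.specialUnitaryGroup (Fin 2) ℂ) : Matrix (Fin 2) (Fin 2) ℂ)) ∂μ ≤
        ∑ e : ↥Λ, (t / 2) ^ 2 * L e ^ 2 * ∫ U, Real.exp (t * F U) ∂μ := by
      refine Finset.sum_le_sum fun e _ => ?_
      have hgc : Continuous fun U : LGConfig 3 (Matrix.specialUnitaryGroup (Fin 2) ℂ) =>
          linkGradSq Λ g e (fun e' : ↥Λ => ((U e'.1 : Matrix.specialUnitaryGroup (Fin 2) ℂ) : Matrix (Fin 2) (Fin 2) ℂ)) :=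
        (continuous_linkGradSq Λ hgC e).comp hres
      calc ∫ U, linkGradSq Λ g e (fun e' : ↥Λ => ((U e'.1 : Matrix.specialUnitaryGroup (Fin 2) ℂ) : Matrix (Fin 2) (Fin 2) ℂ)) ∂μ
          ≤ ∫ U, (t / 2) ^ 2 * Real.exp (t * F U) * L e ^ 2 ∂μ :=
            integral_mono (integrable_of_continuous_of_compactSpace hgc _) ((hexpi.const_mul _).mul_const _) fun U => hgrad e U
        _ = (t / 2) ^ 2 * L e ^ 2 * ∫ U, Real.exp (t * F U) ∂μ := by
            rw [← integral_const_mul]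
            refine integral_congr_ae (ae_of_all _ fun U => ?_)
            ring
    have hI0 : 0 ≤ ∫ U, Real.exp (t * F U) ∂μ := integral_nonneg fun U => (Real.exp_pos _).le
    calc (∫ U, (t * F U) * Real.exp (t * F U) ∂μ) - (∫ U, Real.exp (t * F U) ∂μ) * Real.log (∫ U, Real.exp (t * F U) ∂μ)
        = (∫ U, Real.exp (t * F U) * (t * F U) ∂μ) - (∫ U, Real.exp (t * F U) ∂μ) * Real.log (∫ U, Real.exp (t * F U) ∂μ) := by
          congr 1
          exact integral_congr_ae (ae_of_all _ fun U => mul_comm _ _)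
      _ ≤ 2 / (1 - 24 * |β|) * ∑ e : ↥Λ, ∫ U, linkGradSq Λ g e
            (fun e' : ↥Λ => ((U e'.1 : Matrix.specialUnitaryGroup (Fin 2) ℂ) : Matrix (Fin 2) (Fin 2) ℂ)) ∂μ := hLS
      _ ≤ 2 / (1 - 24 * |β|) * ∑ e : ↥Λ, (t / 2) ^ 2 * L e ^ 2 * ∫ U, Real.exp (t * F U) ∂μ :=
          mul_le_mul_of_nonneg_left hsum_le (by positivity)
      _ = (∑ e, L e ^ 2) / (2 * (1 - 24 * |β|)) * t ^ 2 * ∫ U, Real.exp (t * F U) ∂μ := by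
          rw [← Finset.sum_mul, ← Finset.mul_sum]
          have hKne : (1 - 24 * |β|) ≠ 0 := hK.ne'
          field_simp
  exact integral_exp_mul_le_of_entropy_le μ hFm hC hEnt hl

/-- ★★★ **Gaussian concentration of Lipschitz cylinder observables under every infinite-volume limit point, `|β| < 1/24`.**  For every limit
point `μ` of the torus `SU(2)` Wilson states at tree coupling `2β` (3D, 't Hooft `|β| < 1/24`), every finite `Λ ⊆ E⁺(ℤ³)`, every smooth `f` that
is `L_e`-Lipschitz in the link `e` with `Σ_e L_e² > 0`, and every `r ≥ 0`:
`μ{U : ∫F dμ + r ≤ F(U)} ≤ exp(−(1 − 24|β|)·r²/(2 Σ_e L_e²))`, `F = f((U_e)_(e∈Λ))` — sub-Gaussian fluctuations of Wilson loops and all Lipschitz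
local observables in every strong-coupling infinite-volume state, with Shen–Zhu–Zhu's Bakry–Émery constant.  HONEST FRAMING: strong coupling,
fixed lattice; not a continuum or mass-gap statement. [cite: ShenZhuZhu2022, Theorem 1.4 (1.9) and Corollary 1.5] -/
theorem szz_concentration_su2_sharp {β : ℝ} (hβ : |β| < 1 / 24)
    {μ : Measure (LGConfig 3 (Matrix.specialUnitaryGroup (Fin 2) ℂ))}
    (hμ : μ ∈ infiniteVolumeLimitPoints (d := 3) (fundamentalRep (Fin 2)) (((2 : ℕ) : ℝ) * β))
    (Λ : Finset (Literature.MathematicalPhysics.QuantumLattice.ZdEdge 3)) (f : (↥Λ → Matrix (Fin 2) (Fin 2) ℂ) → ℝ) (hf : ContDiff ℝ ∞ f)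
    (L : ↥Λ → ℝ) (hL : ∀ e, 0 ≤ L e) (hS : 0 < ∑ e, L e ^ 2)
    (hLip : ∀ (e : ↥Λ) (M M' : ↥Λ → Matrix.specialUnitaryGroup (Fin 2) ℂ), (∀ e', e' ≠ e → M e' = M' e') →
      |f (fun e' => (M e' : Matrix (Fin 2) (Fin 2) ℂ)) - f (fun e' => (M' e' : Matrix (Fin 2) (Fin 2) ℂ))| ≤ L e * suFrobDist (M e) (M' e))
    {r : ℝ} (hr : 0 ≤ r) :
    μ.real {U | (∫ V, matrixCylinder Λ f V ∂μ) + r ≤ matrixCylinder Λ f U} ≤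
      Real.exp (-((1 - 24 * |β|) * r ^ 2 / (2 * ∑ e, L e ^ 2))) := by
  classical
  obtain ⟨Ls, hLs, hprob, hlim⟩ := hμ
  haveI := hprob
  have hμ' : μ ∈ infiniteVolumeLimitPoints (d := 3) (fundamentalRep (Fin 2)) (((2 : ℕ) : ℝ) * β) := ⟨Ls, hLs, hprob, hlim⟩
  have hK : 0 < 1 - 24 * |β| := by linarith
  set F : LGConfig 3 (Matrix.specialUnitaryGroup (Fin 2) ℂ) → ℝ := matrixCylinder Λ f with hF
  have hres : Continuous fun U : LGConfig 3 (Matrix.specialUnitaryGroup (Fin 2) ℂ) =>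
      (fun e' : ↥Λ => ((U e'.1 : Matrix.specialUnitaryGroup (Fin 2) ℂ) : Matrix (Fin 2) (Fin 2) ℂ)) :=
    continuous_pi fun e => continuous_subtype_val.comp (continuous_apply _)
  have hFc : Continuous F := hf.continuous.comp hres
  have hFm : Measurable F := hFc.measurable
  obtain ⟨C, hC⟩ : ∃ C, ∀ U, |F U| ≤ C := by
    obtain ⟨C, hC⟩ := (isCompact_univ (X := LGConfig 3 (Matrix.specialUnitaryGroup (Fin 2) ℂ))).exists_bound_of_continuousOn hFc.continuousOn
    exact ⟨C, fun U => by simpa [Real.norm_eq_abs] using hC U (Set.mem_univ _)⟩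
  set κ : ℝ := (∑ e, L e ^ 2) / (2 * (1 - 24 * |β|)) with hκ
  have hκpos : 0 < κ := by rw [hκ]; positivity
  -- Herbst's entropy hypothesis, as in `szz_laplace_le_su2_sharp` (re-derived through the Laplace bound is not enough; use the same route)
  have hEnt : ∀ t : ℝ, 0 < t →
      (∫ U, (t * F U) * Real.exp (t * F U) ∂μ) - (∫ U, Real.exp (t * F U) ∂μ) * Real.log (∫ U, Real.exp (t * F U) ∂μ) ≤
        κ * t ^ 2 * ∫ U, Real.exp (t * F U) ∂μ := by
    intro t ht
    have hfd : Differentiable ℝ f := hf.differentiable (by simp)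
    have hN : (2 : ℕ) ≠ 0 := by norm_num
    set g : (↥Λ → Matrix (Fin 2) (Fin 2) ℂ) → ℝ := fun m => Real.exp (t / 2 * f m) with hg
    have hgC : ContDiff ℝ ∞ g := Real.contDiff_exp.comp (contDiff_const.mul hf)
    have hLS := (szzGradientForm_su2_sharp hβ hμ' Λ g hgC).1
    have hG2 : ∀ U, matrixCylinder Λ g U ^ 2 = Real.exp (t * F U) := by
      intro U
      show Real.exp (t / 2 * f _) ^ 2 = Real.exp (t * f _)
      rw [sq, ← Real.exp_add]; ring_nf
    simp_rw [hG2, Real.log_exp] at hLS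
    have hgrad : ∀ (e : ↥Λ) (U : LGConfig 3 (Matrix.specialUnitaryGroup (Fin 2) ℂ)),
        linkGradSq Λ g e (fun e' : ↥Λ => ((U e'.1 : Matrix.specialUnitaryGroup (Fin 2) ℂ) : Matrix (Fin 2) (Fin 2) ℂ)) ≤
          (t / 2) ^ 2 * Real.exp (t * F U) * L e ^ 2 := by
      intro e U
      have h1 := linkGradSq_exp_mul Λ hfd (t / 2) e (fun e' : ↥Λ => ((U e'.1 : Matrix.specialUnitaryGroup (Fin 2) ℂ) : Matrix (Fin 2) (Fin 2) ℂ))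
      have h2 := linkGradSq_le_sq_of_linkLipschitz hN Λ hfd e (hL e) (hLip e) (fun e' : ↥Λ => U e'.1)
      have hexp : Real.exp (t / 2 * f (fun e' : ↥Λ => ((U e'.1 : Matrix.specialUnitaryGroup (Fin 2) ℂ) : Matrix (Fin 2) (Fin 2) ℂ))) ^ 2 =
          Real.exp (t * F U) := by
        show Real.exp (t / 2 * f _) ^ 2 = Real.exp (t * f _)
        rw [sq, ← Real.exp_add]; ring_nf
      have hge : linkGradSq Λ g e (fun e' : ↥Λ => ((U e'.1 : Matrix.specialUnitaryGroup (Fin 2) ℂ) : Matrix (Fin 2) (Fin 2) ℂ)) =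
          (t / 2) ^ 2 * Real.exp (t * F U) *
            linkGradSq Λ f e (fun e' : ↥Λ => ((U e'.1 : Matrix.specialUnitaryGroup (Fin 2) ℂ) : Matrix (Fin 2) (Fin 2) ℂ)) := by
        show linkGradSq Λ (fun m => Real.exp (t / 2 * f m)) e _ = _
        rw [h1, mul_pow, hexp]
      rw [hge]
      exact mul_le_mul_of_nonneg_left h2 (by positivity)
    have hexpc : Continuous fun U => Real.exp (t * F U) := Real.continuous_exp.comp (continuous_const.mul hFc)
    have hexpi : Integrable (fun U => Real.exp (t * F U)) μ := integrable_of_continuous_of_compactSpace hexpc _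
    have hsum_le : ∑ e : ↥Λ, ∫ U, linkGradSq Λ g e (fun e' : ↥Λ => ((U e'.1 : Matrix.specialUnitaryGroup (Fin 2) ℂ) : Matrix (Fin 2) (Fin 2) ℂ)) ∂μ ≤
        ∑ e : ↥Λ, (t / 2) ^ 2 * L e ^ 2 * ∫ U, Real.exp (t * F U) ∂μ := by
      refine Finset.sum_le_sum fun e _ => ?_
      have hgc : Continuous fun U : LGConfig 3 (Matrix.specialUnitaryGroup (Fin 2) ℂ) =>
          linkGradSq Λ g e (fun e' : ↥Λ => ((U e'.1 : Matrix.specialUnitaryGroup (Fin 2) ℂ) : Matrix (Fin 2) (Fin 2) ℂ)) :=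
        (continuous_linkGradSq Λ hgC e).comp hres
      calc ∫ U, linkGradSq Λ g e (fun e' : ↥Λ => ((U e'.1 : Matrix.specialUnitaryGroup (Fin 2) ℂ) : Matrix (Fin 2) (Fin 2) ℂ)) ∂μ
          ≤ ∫ U, (t / 2) ^ 2 * Real.exp (t * F U) * L e ^ 2 ∂μ :=
            integral_mono (integrable_of_continuous_of_compactSpace hgc _) ((hexpi.const_mul _).mul_const _) fun U => hgrad e U
        _ = (t / 2) ^ 2 * L e ^ 2 * ∫ U, Real.exp (t * F U) ∂μ := by
            rw [← integral_const_mul]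
            refine integral_congr_ae (ae_of_all _ fun U => ?_)
            ring
    calc (∫ U, (t * F U) * Real.exp (t * F U) ∂μ) - (∫ U, Real.exp (t * F U) ∂μ) * Real.log (∫ U, Real.exp (t * F U) ∂μ)
        = (∫ U, Real.exp (t * F U) * (t * F U) ∂μ) - (∫ U, Real.exp (t * F U) ∂μ) * Real.log (∫ U, Real.exp (t * F U) ∂μ) := by
          congr 1
          exact integral_congr_ae (ae_of_all _ fun U => mul_comm _ _)
      _ ≤ 2 / (1 - 24 * |β|) * ∑ e : ↥Λ, ∫ U, linkGradSq Λ g e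
            (fun e' : ↥Λ => ((U e'.1 : Matrix.specialUnitaryGroup (Fin 2) ℂ) : Matrix (Fin 2) (Fin 2) ℂ)) ∂μ := hLS
      _ ≤ 2 / (1 - 24 * |β|) * ∑ e : ↥Λ, (t / 2) ^ 2 * L e ^ 2 * ∫ U, Real.exp (t * F U) ∂μ :=
          mul_le_mul_of_nonneg_left hsum_le (by positivity)
      _ = κ * t ^ 2 * ∫ U, Real.exp (t * F U) ∂μ := by
          rw [← Finset.sum_mul, ← Finset.mul_sum, hκ]
          have hKne : (1 - 24 * |β|) ≠ 0 := hK.ne'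
          field_simp
  have h := measureReal_ge_le_exp_of_entropy_le μ hFm hC hκpos hEnt hr
  have hexp_eq : r ^ 2 / (4 * κ) = (1 - 24 * |β|) * r ^ 2 / (2 * ∑ e, L e ^ 2) := by
    rw [hκ]
    have hKne : (1 - 24 * |β|) ≠ 0 := hK.ne'
    have hSne : (∑ e, L e ^ 2) ≠ 0 := hS.ne'
    field_simp
    ring
  rw [hexp_eq] at h
  exact h

end Summit.QuantumFields.YangMills.Theorems.ColdStartUniversality
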